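import Mathlib
import Summits.Ventures.PercRepro2.PMK5LocusGZero
import Summits.Ventures.PercRepro2.PMK5Pendant
import Summits.Ventures.PercRepro2.PMTypedTri
import Summits.Ventures.PercRepro2.PMK5PendantBMasses

/-!
# THEOREM 23 — AN UNMARKED LEAF IS INVISIBLE: the crux functional of `K₅ + an unmarked leaf` is the crux functional of
the base, and its equality locus is Theorem 18's `RuleG` (blind cell PercRepro2, mine-2 g24; the last case of «every
six-vertex graph with a leaf»: the five marks `(o, a₁, a₂, a₃, b) = (0, 1, 2, 3, 4)` on `K₅` and the sixth vertex `5`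
an UNMARKED leaf at any of the five vertices — the graphs `ends6` (leaf at `u`) and `ends6b` (leaf at `b`) read with typer-1's marking; the three
other hosts by the same lines on `ends6o` / `ends6r` / `ends6ra`)

Every mass of `Gc` is a connection event among the marks, and a leaf is a dead end (`connEvent6*_eq`), so
(**`gc_unmarked_leaf_*`**) `Gc p ends6x 0 1 2 3 4 = Gc (p ∘ castSucc) ends5 0 1 2 3 4` for EVERY weight of the leaf edge
— the leaf's weight does not enter.  Hence the equality locus of (HCOV) on these families is, for every leaf weight,
exactly Theorem 18's: `Gc ≡ 0` on the face of `S` ⟺ `RuleG S` (608 / 1,024), `Gc > 0` at every interior weight vector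
otherwise (**`gc_unmarked_leaf_zero_iff`**, **`gc_unmarked_leaf_pos_iff`**, stated for the leaf at `u = 3`; `gc_unmarked_leaf_b`
for the leaf at `b`; the three other hosts by the same lines).  Standard axioms.
-/

namespace Summit.Ventures.PercRepro2

open Hub CovForm

namespace K5

namespace PM

section Leaf

variable {R : Type*} [Field R] [LinearOrder R] [IsStrictOrderedRing R]

omit [LinearOrder R] [IsStrictOrderedRing R] in
/-- **The unmarked leaf at `3` is invisible** (every leaf weight). -/
theorem gc_unmarked_leaf_u (p : Fin 11 → R) :
    Gc p Pendant.ends6 0 1 2 3 4 = Gc (p ∘ Fin.castSucc) ends5 0 1 2 3 4 := by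
  unfold Gc DEF EQbo EQb3 EQb3o EQo EQ3 EQ3o PDb PDbo Do gap
  simp only [Pendant.avoidAll6, Pendant.TEvent6_123, Pendant.TEvent6_213, Pendant.PDEvent6, Pendant.c10,
    Pendant.c20, Pendant.c14, Pendant.c24, ← Set.preimage_inter, Pendant.prob_res]

omit [LinearOrder R] [IsStrictOrderedRing R] in
/-- The `T`-, `T′`- and `PD`-events transfer on `ends6b` (the unmarked leaf at `b`). -/
lemma TEvent6b_123 : TEvent PendantB.ends6b 1 2 3 = PendantB.resb ⁻¹' TEvent ends5 1 2 3 := by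
  unfold TEvent
  have h21 := PendantB.connEvent6b_eq 2 1; rw [Pendant.cs2, Pendant.cs1] at h21
  have h23 := PendantB.connEvent6b_eq 2 3; rw [Pendant.cs2, Pendant.cs3] at h23
  rw [h21, h23, Set.preimage_inter, Set.preimage_compl]
omit [LinearOrder R] [IsStrictOrderedRing R] in
/-- The `T`-, `T′`- and `PD`-events transfer on `ends6b` (the unmarked leaf at `b`). -/
lemma TEvent6b_213 : TEvent PendantB.ends6b 2 1 3 = PendantB.resb ⁻¹' TEvent ends5 2 1 3 := by
  unfold TEvent
  have h12 := PendantB.connEvent6b_eq 1 2; rw [Pendant.cs1, Pendant.cs2] at h12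
  have h13 := PendantB.connEvent6b_eq 1 3; rw [Pendant.cs1, Pendant.cs3] at h13
  rw [h12, h13, Set.preimage_inter, Set.preimage_compl]
omit [LinearOrder R] [IsStrictOrderedRing R] in
/-- The `T`-, `T′`- and `PD`-events transfer on `ends6b` (the unmarked leaf at `b`). -/
lemma PDEvent6b : PDEvent PendantB.ends6b 1 2 3 = PendantB.resb ⁻¹' PDEvent ends5 1 2 3 := by
  have h12 := PendantB.connEvent6b_eq 1 2; rw [Pendant.cs1, Pendant.cs2] at h12
  have h31 := PendantB.connEvent6b_eq 3 1; rw [Pendant.cs3, Pendant.cs1] at h31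
  have h32 := PendantB.connEvent6b_eq 3 2; rw [Pendant.cs3, Pendant.cs2] at h32
  simp only [PDEvent, Dtilde, UnionCluster.inU, h12, h31, h32, Set.preimage_inter, Set.preimage_compl,
    Set.preimage_union]

omit [LinearOrder R] [IsStrictOrderedRing R] in
/-- **The unmarked leaf at `b` is invisible.** -/
theorem gc_unmarked_leaf_b (p : Fin 11 → R) :
    Gc p PendantB.ends6b 0 1 2 3 4 = Gc (p ∘ Fin.castSucc) ends5 0 1 2 3 4 := by
  unfold Gc DEF EQbo EQb3 EQb3o EQo EQ3 EQ3o PDb PDbo Do gap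
  simp only [avoidAll6b, TEvent6b_123, TEvent6b_213, PDEvent6b, c10b, c20b, c14b, c24b, ← Set.preimage_inter,
    PendantB.prob_resb]

/-- **THEOREM 23, «IFF»s for the unmarked leaf at `u`**: `Gc ≡ 0` on the face ⟺ `RuleG`, for every leaf weight. -/
theorem gc_unmarked_leaf_zero_iff (m : ℕ) (hm : m < 1024) :
    (∀ p : Fin 11 → R, (∀ e : Fin 11, 0 ≤ p e ∧ p e ≤ 1) →
      (∀ e : Fin 10, m.testBit e = false → p (Fin.castSucc e) = 0) →
      Gc p Pendant.ends6 0 1 2 3 4 = 0) ↔ RuleG m = true := by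
  rw [← gc_K5_zero_iff (R := R) m hm]
  constructor
  · intro h q hq hq₀
    have := h (Fin.snoc (α := fun _ => R) q (1 / 2))
      (fun e => by
        induction e using Fin.lastCases with
        | last => simp only [Fin.snoc_last]; exact ⟨by norm_num, by norm_num⟩
        | cast e => simp only [Fin.snoc_castSucc]; exact hq e)
      (fun e he => by simp only [Fin.snoc_castSucc]; exact hq₀ e he)
    rwa [gc_unmarked_leaf_u, Pendant.snoc_comp_castSucc] at this
  · intro h p hp hp₀
    rw [gc_unmarked_leaf_u]
    exact h (p ∘ Fin.castSucc) (fun e => hp _) hp₀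

/-- **THEOREM 23, positive «iff» for the unmarked leaf at `u`**: `Gc > 0` at every weight vector interior on the base
face (any leaf weight) ⟺ not `RuleG`. -/
theorem gc_unmarked_leaf_pos_iff (m : ℕ) (hm : m < 1024) :
    (∀ p : Fin 11 → R, (∀ e : Fin 10, m.testBit e = true → 0 < p (Fin.castSucc e) ∧ p (Fin.castSucc e) < 1) →
      (∀ e : Fin 10, m.testBit e = false → p (Fin.castSucc e) = 0) →
      0 < Gc p Pendant.ends6 0 1 2 3 4) ↔ RuleG m = false := by
  rw [← gc_K5_pos_iff (R := R) m hm]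
  constructor
  · intro h q hq₁ hq₀
    have := h (Fin.snoc (α := fun _ => R) q (1 / 2))
      (fun e he => by simp only [Fin.snoc_castSucc]; exact hq₁ e he)
      (fun e he => by simp only [Fin.snoc_castSucc]; exact hq₀ e he)
    rwa [gc_unmarked_leaf_u, Pendant.snoc_comp_castSucc] at this
  · intro h p hp₁ hp₀
    rw [gc_unmarked_leaf_u]
    exact h (p ∘ Fin.castSucc) hp₁ hp₀

end Leaf

end PM

end K5

end Summit.Ventures.PercRepro2
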